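import Summits.CriticalPhenomena.PercolationContinuityZ3.Theorems.PercNearOneGluingNoHeavyLowerTailTwoCopyGraphBridge
import Summits.CriticalPhenomena.PercolationContinuityZ3.Theorems.PercNearOneGluingNoHeavyLowerTailQ44GraphHandshake

/-!
# The single-source packing from source-edge monotonicity (MONO-A), all `n`

Support file for crux `stmt-CriticalPhenomena-4575` (master-family programme, row `Q44`, single-source packing
`g ≥ b1 + h_a`), seat `prim-bnk-1` gen 32; memo `run/shared/lean/prim/prim-l12/FROM-prim-bnk-1-gen32-MONO-A.md` §1.

In a graph fibre `(M, C)` of the two-copy expansion (base edges `C` open in both copies, free edges `M`, labelling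
`ι` with `prof a b c y (C ∪ T) = pp (ι T)`), write `count(M) = #goods − #sides`, where the goods are the `T ⊆ M` with
`ι T ∈ AC = {ab|cy, abcy}`, `ι (M ∖ T) = ⊥`, and the sides are the `T ⊆ M` whose cell pair `(ι T, ι (M ∖ T))` is one of the
seven single-source types `(ab|c|y ; a|bcy), (ac|b|y ; a|bcy), (ab|cy ; ac|by), (ab|cy ; ay|bc), (ab|c|y ; ay|bc), (ab|c|y ; a|b|cy),
(ay|bc ; a|b|cy)`.

**MONO-A** (memo §1; 0 failures on > 10⁵ source edges, while the same statement at `b`, `c`, `y` fails): for every free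
edge `e ∈ M` with an endpoint joined to the source `a` by a `C`-path, `count(M ∖ {e}) ≤ count(M)`.

* `reachable_iff_of_untouched` — adding free edges none of whose endpoints is `C`-reachable from `a` does not change
  reachability from `a`;
* `card_sides_eq_zero_of_untouched` — hence a fibre in which no free edge meets the `C`-cluster of `a` has no side
  (every single-source type joins `a` to some marked point in the cell but not in the cocell);
* `sides_le_goods_of_monoA` — MONO-A ⟹ `#sides ≤ #goods` in every fibre (delete the source edges one by one);
* `pack_singleSource_of_monoA` — LAW LEVEL, all `n`: MONO-A for the marked points `a b c y` of `Fin n` implies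
  `P(ab|c|y)P(a|bcy) + P(ac|b|y)P(a|bcy) + P(ab|cy)P(ac|by) + P(ab|cy)P(ay|bc) + P(ab|c|y)P(ay|bc) + P(ab|c|y)P(a|b|cy)
   + P(ay|bc)P(a|b|cy) ≤ [P(ab|cy)+P(abcy)]·P(a|b|c|y)` on every finite weighted graph on `Fin n`.

So MONO-A is now the single named hypothesis of the full single-source law (it replaces the CORE-A/CORE-B odd-target
hypotheses of `pack_singleSource_of_cores`, refuted in gen 31).  No sorries, no definitions, standard axioms.
-/

namespace Summit.CriticalPhenomena.PercolationContinuityZ3.Theorems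

namespace TwoCopyMono

open Finset FourPointAtoms Literature.Probability.Percolation

variable {n : ℕ}

/-! ## Reachability from the source is frozen when no free edge meets its cluster -/

/-- If no edge of `S` has an endpoint joined to `a` in `C`, then adding `S` does not change reachability from `a`.
[folklore] -/
theorem reachable_iff_of_untouched (C S : Finset (Sym2 (Fin n))) (a t : Fin n)
    (hS : ∀ e ∈ S, ∀ v : Fin n, v ∈ e → ¬ (openGraph (↑C : Set (Sym2 (Fin n)))).Reachable a v) :
    (openGraph (↑(C ∪ S) : Set (Sym2 (Fin n)))).Reachable a t ↔
      (openGraph (↑C : Set (Sym2 (Fin n)))).Reachable a t := by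
  constructor
  · intro h
    set G₁ := openGraph (↑(C ∪ S) : Set (Sym2 (Fin n))) with hG₁
    set G₂ := openGraph (↑C : Set (Sym2 (Fin n))) with hG₂
    -- every `G₁`-edge out of the `C`-cluster of `a` is a `C`-edge
    have hedge : ∀ u v : Fin n, G₂.Reachable a u → G₁.Adj u v → G₂.Adj u v := by
      intro u v hu huv
      rw [hG₁, openGraph_coe_adj] at huv
      rw [hG₂, openGraph_coe_adj]
      refine ⟨?_, huv.2⟩
      rcases Finset.mem_union.1 huv.1 with h1 | h1
      · exact h1
      · exact absurd hu (hS _ h1 u (Sym2.mem_mk_left u v))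
    refine reachable_transfer G₁ G₂ {u | G₂.Reachable a u} ?_ ?_ (SimpleGraph.Reachable.refl a) h
    · intro u v hu huv
      exact SimpleGraph.Reachable.trans hu (SimpleGraph.Adj.reachable (hedge u v hu huv))
    · intro u v hu _ huv
      exact hedge u v hu huv
  · intro h
    exact reachable_mono_finset Finset.subset_union_left h

/-- The `a`-row of the profile is frozen when no free edge meets the `C`-cluster of `a`. [this work] -/
theorem prof_arow_eq_of_untouched (a b c y : Fin n) (C S : Finset (Sym2 (Fin n)))
    (hS : ∀ e ∈ S, ∀ v : Fin n, v ∈ e → ¬ (openGraph (↑C : Set (Sym2 (Fin n)))).Reachable a v) (j : Fin 4) :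
    prof a b c y ↑(C ∪ S) 0 j = prof a b c y ↑C 0 j := by
  rw [Bool.eq_iff_iff, prof_true_iff, prof_true_iff]
  exact reachable_iff_of_untouched C S a _ hS

/-- Table fact: every single-source type joins `a` to some marked point in the cell and separates them in the cocell.
[this work] -/
theorem singleSource_arow :
    ∀ p ∈ ({(6, 7), (5, 7), (11, 9), (11, 8), (6, 8), (6, 1), (8, 1)} : Finset (Fin 15 × Fin 15)),
      ∃ j : Fin 4, pp p.1 0 j = true ∧ pp p.2 0 j = false := by
  intro p hp
  simp only [Finset.mem_insert, Finset.mem_singleton] at hp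
  rcases hp with rfl | rfl | rfl | rfl | rfl | rfl | rfl
  · exact ⟨1, by decide, by decide⟩
  · exact ⟨2, by decide, by decide⟩
  · exact ⟨1, by decide, by decide⟩
  · exact ⟨1, by decide, by decide⟩
  · exact ⟨1, by decide, by decide⟩
  · exact ⟨1, by decide, by decide⟩
  · exact ⟨3, by decide, by decide⟩

/-- **Base case.**  If no free edge of the fibre meets the `C`-cluster of `a`, the fibre has no single-source side.
[this work] -/
theorem card_sides_eq_zero_of_untouched (a b c y : Fin n) (M C : Finset (Sym2 (Fin n)))
    (ι : Finset (Sym2 (Fin n)) → Fin 15) (hι : ∀ T : Finset (Sym2 (Fin n)), prof a b c y ↑(C ∪ T) = pp (ι T))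
    (hM : ∀ e ∈ M, ∀ v : Fin n, v ∈ e → ¬ (openGraph (↑C : Set (Sym2 (Fin n)))).Reachable a v) :
    #(M.powerset.filter fun T => (ι T, ι (M \ T)) ∈
        ({(6, 7), (5, 7), (11, 9), (11, 8), (6, 8), (6, 1), (8, 1)} : Finset (Fin 15 × Fin 15))) = 0 := by
  rw [Finset.card_eq_zero, Finset.filter_eq_empty_iff]
  intro T hT hmem
  rw [Finset.mem_powerset] at hT
  obtain ⟨j, hj1, hj2⟩ := singleSource_arow _ hmem
  have hT' : ∀ e ∈ T, ∀ v : Fin n, v ∈ e → ¬ (openGraph (↑C : Set (Sym2 (Fin n)))).Reachable a v :=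
    fun e he => hM e (hT he)
  have hMT : ∀ e ∈ M \ T, ∀ v : Fin n, v ∈ e → ¬ (openGraph (↑C : Set (Sym2 (Fin n)))).Reachable a v :=
    fun e he => hM e (Finset.sdiff_subset he)
  have h1 : pp (ι T) 0 j = prof a b c y ↑C 0 j := by
    rw [← hι T]; exact prof_arow_eq_of_untouched a b c y C T hT' j
  have h2 : pp (ι (M \ T)) 0 j = prof a b c y ↑C 0 j := by
    rw [← hι (M \ T)]; exact prof_arow_eq_of_untouched a b c y C (M \ T) hMT j
  have h3 : pp (ι T) 0 j = pp (ι (M \ T)) 0 j := h1.trans h2.symm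
  rw [hj1, hj2] at h3
  exact Bool.noConfusion h3

/-! ## The induction on source edges -/

/-- **MONO-A ⟹ the fibre count.**  If deleting a free edge at the `C`-cluster of `a` never increases `#goods − #sides`
(hypothesis `hmono`, for the fixed base set `C` and labelling `ι`), then `#sides ≤ #goods` in the fibre `(M, C)` for every
`M` disjoint from `C`. [this work] -/
theorem sides_le_goods_of_monoA (a b c y : Fin n) (C : Finset (Sym2 (Fin n)))
    (ι : Finset (Sym2 (Fin n)) → Fin 15) (hι : ∀ T : Finset (Sym2 (Fin n)), prof a b c y ↑(C ∪ T) = pp (ι T))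
    (hmono : ∀ M : Finset (Sym2 (Fin n)), Disjoint C M → ∀ e ∈ M,
      (∃ v : Fin n, v ∈ e ∧ (openGraph (↑C : Set (Sym2 (Fin n)))).Reachable a v) →
      ((#((M.erase e).powerset.filter fun T => isAC (ι T) ∧ ι ((M.erase e) \ T) = 0) : ℕ) : ℤ) -
          #((M.erase e).powerset.filter fun T => (ι T, ι ((M.erase e) \ T)) ∈
            ({(6, 7), (5, 7), (11, 9), (11, 8), (6, 8), (6, 1), (8, 1)} : Finset (Fin 15 × Fin 15))) ≤
        ((#(M.powerset.filter fun T => isAC (ι T) ∧ ι (M \ T) = 0) : ℕ) : ℤ) -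
          #(M.powerset.filter fun T => (ι T, ι (M \ T)) ∈
            ({(6, 7), (5, 7), (11, 9), (11, 8), (6, 8), (6, 1), (8, 1)} : Finset (Fin 15 × Fin 15))))
    (M : Finset (Sym2 (Fin n))) (hCM : Disjoint C M) :
    #(M.powerset.filter fun T => (ι T, ι (M \ T)) ∈
        ({(6, 7), (5, 7), (11, 9), (11, 8), (6, 8), (6, 1), (8, 1)} : Finset (Fin 15 × Fin 15))) ≤
      #(M.powerset.filter fun T => isAC (ι T) ∧ ι (M \ T) = 0) := by
  classical
  -- strong induction on the number of free edges
  suffices h : ∀ (k : ℕ) (M : Finset (Sym2 (Fin n))), M.card = k → Disjoint C M →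
      #(M.powerset.filter fun T => (ι T, ι (M \ T)) ∈
          ({(6, 7), (5, 7), (11, 9), (11, 8), (6, 8), (6, 1), (8, 1)} : Finset (Fin 15 × Fin 15))) ≤
        #(M.powerset.filter fun T => isAC (ι T) ∧ ι (M \ T) = 0) from h M.card M rfl hCM
  intro k
  induction k using Nat.strong_induction_on with
  | _ k ih =>
    intro M hk hCM
    by_cases htouch : ∃ e ∈ M, ∃ v : Fin n, v ∈ e ∧ (openGraph (↑C : Set (Sym2 (Fin n)))).Reachable a v
    · obtain ⟨e, heM, hv⟩ := htouch
      have hstep := hmono M hCM e heM hv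
      have hcard : (M.erase e).card < k := by rw [← hk]; exact Finset.card_erase_lt_of_mem heM
      have hdisj : Disjoint C (M.erase e) := Finset.disjoint_of_subset_right (Finset.erase_subset e M) hCM
      have hIH := ih _ hcard (M.erase e) rfl hdisj
      have hIH' : ((#((M.erase e).powerset.filter fun T => (ι T, ι ((M.erase e) \ T)) ∈
            ({(6, 7), (5, 7), (11, 9), (11, 8), (6, 8), (6, 1), (8, 1)} : Finset (Fin 15 × Fin 15))) : ℕ) : ℤ) ≤
          ((#((M.erase e).powerset.filter fun T => isAC (ι T) ∧ ι ((M.erase e) \ T) = 0) : ℕ) : ℤ) := by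
        exact_mod_cast hIH
      have hgoal : ((#(M.powerset.filter fun T => (ι T, ι (M \ T)) ∈
            ({(6, 7), (5, 7), (11, 9), (11, 8), (6, 8), (6, 1), (8, 1)} : Finset (Fin 15 × Fin 15))) : ℕ) : ℤ) ≤
          ((#(M.powerset.filter fun T => isAC (ι T) ∧ ι (M \ T) = 0) : ℕ) : ℤ) := by
        linarith
      exact_mod_cast hgoal
    · have hM : ∀ e ∈ M, ∀ v : Fin n, v ∈ e → ¬ (openGraph (↑C : Set (Sym2 (Fin n)))).Reachable a v :=
        fun e he v hv hr => htouch ⟨e, he, v, hv, hr⟩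
      rw [card_sides_eq_zero_of_untouched a b c y M C ι hι hM]
      exact Nat.zero_le _

/-! ## Law level -/

/-- **The full single-source packing from MONO-A, all `n`.**  Fix marked points `a b c y` of `Fin n`.  Suppose that in every
graph fibre `(M, C)` (with labelling `ι`), deleting a free edge `e ∈ M` that has an endpoint joined to `a` by a `C`-path never
increases `#goods − #sides` (MONO-A).  Then on every finite weighted graph on `Fin n`:
`P(ab|c|y)P(a|bcy) + P(ac|b|y)P(a|bcy) + P(ab|cy)P(ac|by) + P(ab|cy)P(ay|bc) + P(ab|c|y)P(ay|bc) + P(ab|c|y)P(a|b|cy)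
 + P(ay|bc)P(a|b|cy) ≤ [P(ab|cy)+P(abcy)]·P(a|b|c|y)`. [this work] -/
theorem pack_singleSource_of_monoA (a b c y : Fin n)
    (hmono : ∀ (M C : Finset (Sym2 (Fin n))), Disjoint C M → ∀ ι : Finset (Sym2 (Fin n)) → Fin 15,
      (∀ T : Finset (Sym2 (Fin n)), prof a b c y ↑(C ∪ T) = pp (ι T)) → ∀ e ∈ M,
      (∃ v : Fin n, v ∈ e ∧ (openGraph (↑C : Set (Sym2 (Fin n)))).Reachable a v) →
      ((#((M.erase e).powerset.filter fun T => isAC (ι T) ∧ ι ((M.erase e) \ T) = 0) : ℕ) : ℤ) -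
          #((M.erase e).powerset.filter fun T => (ι T, ι ((M.erase e) \ T)) ∈
            ({(6, 7), (5, 7), (11, 9), (11, 8), (6, 8), (6, 1), (8, 1)} : Finset (Fin 15 × Fin 15))) ≤
        ((#(M.powerset.filter fun T => isAC (ι T) ∧ ι (M \ T) = 0) : ℕ) : ℤ) -
          #(M.powerset.filter fun T => (ι T, ι (M \ T)) ∈
            ({(6, 7), (5, 7), (11, 9), (11, 8), (6, 8), (6, 1), (8, 1)} : Finset (Fin 15 × Fin 15))))
    (w : Sym2 (Fin n) → unitInterval) :
    cell w a b c y 6 * cell w a b c y 7 +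
      cell w a b c y 5 * cell w a b c y 7 +
      cell w a b c y 11 * cell w a b c y 9 +
      cell w a b c y 11 * cell w a b c y 8 +
      cell w a b c y 6 * cell w a b c y 8 +
      cell w a b c y 6 * cell w a b c y 1 +
      cell w a b c y 8 * cell w a b c y 1 ≤
      (cell w a b c y 11 + cell w a b c y 14) * cell w a b c y 0 := by
  have h := pack_of_graphFibreCount
    ({(6, 7), (5, 7), (11, 9), (11, 8), (6, 8), (6, 1), (8, 1)} : Finset (Fin 15 × Fin 15)) a b c y
    (fun M C hCM ι hι => sides_le_goods_of_monoA a b c y C ι hι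
      (fun M' hCM' e he hv => hmono M' C hCM' ι hι e he hv) M hCM) w
  rw [Finset.sum_insert (by decide), Finset.sum_insert (by decide), Finset.sum_insert (by decide),
    Finset.sum_insert (by decide), Finset.sum_insert (by decide), Finset.sum_insert (by decide), Finset.sum_singleton] at h
  dsimp only at h
  linarith

end TwoCopyMono

end Summit.CriticalPhenomena.PercolationContinuityZ3.Theorems
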